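import Summits.Schanuel.Schanuel.Theorems.TateLocusGPCOne.Negative.TateLocusGPCOneCalibration

/-!
# `TateLocusGPCOne` (crux stmt-Schanuel-17406): the algebraic nome `q = (3 + 4i)/10` — a certified
# point of the crux's domain, tightness there, and `τ` is load-bearing — negative-side support
# (standing disprover, cycle 1, file 3 of 3)

For the crux `5 ≤ trdeg_ℚ ℚ(2πi, τ, q, P(q), Q(q), R(q))` (`Im τ > 0`, `τ` non-quadratic):

* `tateLocusGPCOne_hypotheses_at_algebraic_nome` — at `τ_α = log α / 2πi`, `α = (3 + 4i)/10`, the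
  crux's hypotheses hold WITHOUT any transcendence input: `e^{2πiτ_α} = α`, `Im τ_α = log 2/2π > 0`,
  and `τ_α` is not a root of a monic rational quadratic because a non-real quadratic `τ` has
  rational real part, whereas `Re τ_α = p/n` would force `αⁿ = e^{2πi n τ_α} ∈ ℝ`, i.e.
  `(3 + 4i)ⁿ ∈ ℝ`, impossible since `(3 + 4i)ⁿ ≡ 3 + 4i (mod 5)` (`im_three_add_four_I_pow_ne_zero`).
  This is a certified test point of the "algebraic nome" fibre, on which the crux reads
  "`2πi, log q, P(q), Q(q), R(q)` algebraically independent" (⊋ `π ⊥ log α`; `P, Q, R(q)` alone are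
  independent by Nesterenko).
* `trdeg_le_five_at_algebraic_nome` — there the six generators have `trdeg ≤ 5`: the crux's `5` is
  the most one can claim on this fibre (tightness, modulo the conjecture itself).
* `tateLocusGPCOne_false_without_gen_tau` — deleting `τ` from the generator list makes the count
  `5` FALSE (at `τ_α`: `trdeg ℚ(2πi, α, P(α), Q(α), R(α)) ≤ 4`): `τ = log q/2πi` carries a full
  degree on this fibre.

Sorry-free, standard axioms. Nothing here refutes the crux.
-/

noncomputable section

set_option linter.dupNamespace false

namespace Summit.Schanuel.Schanuel.Theorems.TateLocusGPCOne.Negative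

open Complex IntermediateField Filter
open Literature.Barriers.Schanuel

/-! ### The algebraic nome `q = (3 + 4i)/10`: a certified point of the crux's domain with no
transcendence input, and `τ` is load-bearing there -/

section algebraicNome


/-- `α ≠ 0`. -/
theorem alpha0_ne_zero : ((3 + 4 * Complex.I) / 10 : ℂ) ≠ 0 := by
  intro h
  have := congrArg Complex.re h
  norm_num at this

/-- `‖α‖ = 1/2`. -/
theorem norm_alpha0 : ‖((3 + 4 * Complex.I) / 10 : ℂ)‖ = 1 / 2 := by
  rw [norm_div]
  have h34 : ‖(3 + 4 * Complex.I : ℂ)‖ = 5 := by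
    have := Complex.norm_add_mul_I 3 4
    push_cast at this
    rw [this, show ((3 : ℝ) ^ 2 + 4 ^ 2) = 5 ^ 2 by norm_num, Real.sqrt_sq (by norm_num)]
  rw [h34]
  norm_num

/-- `e^{2πi τ_α} = α`. -/
theorem exp_tauAlpha : Complex.exp (2 * Real.pi * Complex.I * (Complex.log ((3 + 4 * Complex.I) / 10) / (2 * (Real.pi : ℂ) * Complex.I))) = ((3 + 4 * Complex.I) / 10 : ℂ) := by
  rw [mul_div_cancel₀ _ Complex.two_pi_I_ne_zero]
  exact Complex.exp_log alpha0_ne_zero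

/-- `Im τ_α = log 2 / 2π`. -/
theorem tauAlpha_im : Complex.im (Complex.log ((3 + 4 * Complex.I) / 10) / (2 * (Real.pi : ℂ) * Complex.I)) = Real.log 2 / (2 * Real.pi) := by
  have hre : (Complex.log ((3 + 4 * Complex.I) / 10 : ℂ)).re = -Real.log 2 := by
    rw [Complex.log_re, norm_alpha0, one_div, Real.log_inv]
  rw [Complex.div_im]
  simp only [Complex.mul_re, Complex.mul_im, Complex.re_ofNat, Complex.im_ofNat,
    Complex.ofReal_re, Complex.ofReal_im, Complex.I_re, Complex.I_im, hre]
  have hπ : Real.pi ≠ 0 := Real.pi_ne_zero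
  simp [Complex.normSq_apply]
  field_simp

/-- `Im τ_α > 0`. -/
theorem tauAlpha_im_pos : 0 < Complex.im (Complex.log ((3 + 4 * Complex.I) / 10) / (2 * (Real.pi : ℂ) * Complex.I)) := by
  rw [tauAlpha_im]
  exact div_pos (Real.log_pos one_lt_two) (by positivity)

/-- `(3 + 4i)ⁿ ≡ 3 + 4i (mod 5)` for `n ≥ 1`; in particular its imaginary part never vanishes, so
no power of `3 + 4i` is real (`arg(3+4i)/π ∉ ℚ`). [folklore] -/
theorem im_three_add_four_I_pow_ne_zero {n : ℕ} (hn : 1 ≤ n) :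
    ((3 + 4 * Complex.I : ℂ) ^ n).im ≠ 0 := by
  -- `(3 + 4i)ⁿ = a + b i` with integers `a ≡ 3`, `b ≡ 4 (mod 5)`
  have key : ∃ a b : ℤ, (3 + 4 * Complex.I : ℂ) ^ n = (a : ℂ) + (b : ℂ) * Complex.I ∧
      a % 5 = 3 ∧ b % 5 = 4 := by
    induction n, hn using Nat.le_induction with
    | base => exact ⟨3, 4, by push_cast; ring, by norm_num, by norm_num⟩
    | succ m hm ih =>
      obtain ⟨a, b, hab, ha, hb⟩ := ih
      refine ⟨3 * a - 4 * b, 4 * a + 3 * b, ?_, ?_, ?_⟩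
      · rw [pow_succ, hab]
        apply Complex.ext <;> simp <;> ring
      · omega
      · omega
  obtain ⟨a, b, hab, -, hb⟩ := key
  rw [hab]
  simp only [Complex.add_im, Complex.intCast_im, Complex.mul_im, Complex.intCast_re, Complex.I_im,
    Complex.I_re, mul_zero, mul_one, zero_add, add_zero]
  have : b ≠ 0 := by rintro rfl; norm_num at hb
  exact_mod_cast this

/-- **`τ_α` is not a root of a monic rational quadratic** — with no transcendence theory: a
non-real root of `X² + bX + c ∈ ℚ[X]` has real part `−b/2 ∈ ℚ`; but `Re τ_α = p/n` would give
`α^n = e^{2πi n τ_α} = e^{2πi p} e^{−2π n Im τ_α} ∈ ℝ`, i.e. `(3+4i)ⁿ ∈ ℝ`, contradicting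
`im_three_add_four_I_pow_ne_zero`. -/
theorem tauAlpha_nonQuadratic : ∀ b c : ℚ, (Complex.log ((3 + 4 * Complex.I) / 10) / (2 * (Real.pi : ℂ) * Complex.I)) ^ 2 + (b : ℂ) * (Complex.log ((3 + 4 * Complex.I) / 10) / (2 * (Real.pi : ℂ) * Complex.I)) + (c : ℂ) ≠ 0 := by
  intro b c
  obtain ⟨t, ht⟩ : ∃ t : ℂ, t = (Complex.log ((3 + 4 * Complex.I) / 10) / (2 * (Real.pi : ℂ) * Complex.I)) := ⟨_, rfl⟩
  have htim : 0 < t.im := by rw [ht]; exact tauAlpha_im_pos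
  have hexp_t : Complex.exp (2 * Real.pi * Complex.I * t) = ((3 + 4 * Complex.I) / 10 : ℂ) := by rw [ht]; exact exp_tauAlpha
  rw [← ht]
  intro h
  -- imaginary parts: `Im t · (2 Re t + b) = 0`, hence `Re t = -b/2`
  have him := congrArg Complex.im h
  simp only [Complex.add_im, Complex.mul_im, sq, Complex.ratCast_re, Complex.ratCast_im,
    Complex.zero_im, zero_mul, add_zero] at him
  set r : ℚ := -b / 2 with hr
  have hre : t.re = (r : ℝ) := by
    have : t.im * (2 * t.re + b) = 0 := by nlinarith [him]
    rcases mul_eq_zero.mp this with h0 | h0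
    · exact absurd h0 (ne_of_gt htim)
    · rw [hr]; push_cast; linarith
  -- write `r = p/n`, `n = r.den ≥ 1`, `p = r.num`
  have hnum : (r.den : ℚ) * r = r.num := by rw [mul_comm]; exact Rat.mul_den_eq_num r
  have hden : 1 ≤ r.den := r.den_pos
  -- `n • t = p + i n Im t`
  have hnt : (r.den : ℂ) * t = (r.num : ℂ) + (((r.den : ℝ) * t.im : ℝ) : ℂ) * Complex.I := by
    apply Complex.ext
    · simp only [Complex.mul_re, Complex.natCast_re, Complex.natCast_im, zero_mul, sub_zero,
        Complex.add_re, Complex.intCast_re, Complex.ofReal_re, Complex.I_re, mul_zero,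
        Complex.ofReal_im, Complex.I_im, add_zero, hre]
      have := congrArg (fun x : ℚ => (x : ℝ)) hnum
      push_cast at this ⊢
      linarith
    · simp only [Complex.mul_im, Complex.natCast_re, Complex.natCast_im, zero_mul, add_zero,
        Complex.add_im, Complex.intCast_im, Complex.ofReal_re, Complex.I_im, mul_one,
        Complex.ofReal_im, Complex.I_re, mul_zero, zero_add]
  -- `α^n = e^{2πi n t}` is real
  have hexp : ((3 + 4 * Complex.I) / 10 : ℂ) ^ r.den = Complex.exp (2 * Real.pi * Complex.I * ((r.den : ℂ) * t)) := by
    rw [← hexp_t, ← Complex.exp_nat_mul]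
    congr 1
    ring
  have hreal : (((3 + 4 * Complex.I) / 10 : ℂ) ^ r.den).im = 0 := by
    rw [hexp, hnt, mul_add, Complex.exp_add]
    have h1 : Complex.exp (2 * Real.pi * Complex.I * (r.num : ℂ)) = 1 := by
      rw [show 2 * (Real.pi : ℂ) * Complex.I * (r.num : ℂ) =
        (r.num : ℂ) * (2 * Real.pi * Complex.I) by ring]
      exact Complex.exp_int_mul_two_pi_mul_I r.num
    have h2 : 2 * (Real.pi : ℂ) * Complex.I * ((((r.den : ℝ) * t.im : ℝ) : ℂ) * Complex.I) =
        ((-(2 * Real.pi * ((r.den : ℝ) * t.im)) : ℝ) : ℂ) := by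
      push_cast
      linear_combination (2 * (Real.pi : ℂ) * ((r.den : ℂ) * (t.im : ℂ))) * Complex.I_sq
    rw [h1, one_mul, h2, ← Complex.ofReal_exp]
    exact Complex.ofReal_im _
  -- but `α^n = (3+4i)^n / 10^n` has non-zero imaginary part
  have hsplit : ((3 + 4 * Complex.I) / 10 : ℂ) ^ r.den = (3 + 4 * Complex.I) ^ r.den / (((10 : ℝ) ^ r.den : ℝ) : ℂ) := by
    push_cast
    rw [div_pow]
  rw [hsplit, Complex.div_ofReal_im, div_eq_zero_iff] at hreal
  rcases hreal with h0 | h0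
  · exact im_three_add_four_I_pow_ne_zero hden h0
  · exact absurd h0 (by positivity)

/-- `α = (3 + 4i)/10` is algebraic over `ℚ`: a root of `20X² − 12X + 5`. -/
theorem isAlgebraic_alpha0 : IsAlgebraic ℚ ((3 + 4 * Complex.I) / 10 : ℂ) := by
  refine ⟨20 * Polynomial.X ^ 2 - 12 * Polynomial.X + 5, fun h => ?_, ?_⟩
  · have h0 := congrArg (Polynomial.eval 0) h
    norm_num at h0
  · have hα : ((3 + 4 * Complex.I) / 10 : ℂ) = Complex.mk (3 / 10) (2 / 5) := by
      apply Complex.ext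
      · simp
      · simp; norm_num
    simp only [map_add, map_sub, map_mul, map_pow, Polynomial.aeval_X, map_ofNat]
    rw [hα]
    apply Complex.ext <;> simp [sq] <;> norm_num

/-- **The crux's hypotheses hold at the algebraic nome `q = (3+4i)/10`** — a certified point of
the "algebraic nome" fibre (`Im τ > 0`, `τ` non-quadratic, `e^{2πiτ} ∈ ℚ̄`), obtained without
Gelfond–Schneider. There the crux asserts that `2πi, log q, P(q), Q(q), R(q)` are algebraically
independent (`P, Q, R(q)` alone are, by Nesterenko; the joint statement contains `π ⊥ log q`). -/
theorem tateLocusGPCOne_hypotheses_at_algebraic_nome :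
    ∃ τ : ℂ, 0 < τ.im ∧ (∀ b c : ℚ, τ ^ 2 + (b : ℂ) * τ + (c : ℂ) ≠ 0) ∧
      IsAlgebraic ℚ (Complex.exp (2 * Real.pi * Complex.I * τ)) :=
  ⟨(Complex.log ((3 + 4 * Complex.I) / 10) / (2 * (Real.pi : ℂ) * Complex.I)), tauAlpha_im_pos, tauAlpha_nonQuadratic, by rw [exp_tauAlpha]; exact isAlgebraic_alpha0⟩


/-- **Tightness at the algebraic nome**: at `τ_α` the six generators have `trdeg ≤ 5` (the nome is
algebraic), so the crux's `5` is attained-or-violated there, never exceeded. -/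
theorem trdeg_le_five_at_algebraic_nome :
    Algebra.trdeg ℚ ↥(adjoin ℚ
      ({2 * (Real.pi : ℂ) * Complex.I, (Complex.log ((3 + 4 * Complex.I) / 10) / (2 * (Real.pi : ℂ) * Complex.I)), Complex.exp (2 * Real.pi * Complex.I * (Complex.log ((3 + 4 * Complex.I) / 10) / (2 * (Real.pi : ℂ) * Complex.I))),
        1 - 24 * ∑' l : ℕ, (ArithmeticFunction.sigma 1 (l + 1) : ℂ) *
          Complex.exp (2 * Real.pi * Complex.I * (Complex.log ((3 + 4 * Complex.I) / 10) / (2 * (Real.pi : ℂ) * Complex.I))) ^ (l + 1),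
        1 + 240 * ∑' l : ℕ, (ArithmeticFunction.sigma 3 (l + 1) : ℂ) *
          Complex.exp (2 * Real.pi * Complex.I * (Complex.log ((3 + 4 * Complex.I) / 10) / (2 * (Real.pi : ℂ) * Complex.I))) ^ (l + 1),
        1 - 504 * ∑' l : ℕ, (ArithmeticFunction.sigma 5 (l + 1) : ℂ) *
          Complex.exp (2 * Real.pi * Complex.I * (Complex.log ((3 + 4 * Complex.I) / 10) / (2 * (Real.pi : ℂ) * Complex.I))) ^ (l + 1)} : Set ℂ)) ≤ (5 : Cardinal) := by
  rw [exp_tauAlpha]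
  have h := trdeg_adjoin_le_of_subset_range_union
    ![2 * (Real.pi : ℂ) * Complex.I, (Complex.log ((3 + 4 * Complex.I) / 10) / (2 * (Real.pi : ℂ) * Complex.I)), (1 - 24 * ∑' l : ℕ, (ArithmeticFunction.sigma 1 (l + 1) : ℂ) *
        ((3 + 4 * Complex.I) / 10 : ℂ) ^ (l + 1)), (1 + 240 * ∑' l : ℕ, (ArithmeticFunction.sigma 3 (l + 1) : ℂ) *
        ((3 + 4 * Complex.I) / 10 : ℂ) ^ (l + 1)), (1 - 504 * ∑' l : ℕ, (ArithmeticFunction.sigma 5 (l + 1) : ℂ) *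
        ((3 + 4 * Complex.I) / 10 : ℂ) ^ (l + 1))] {((3 + 4 * Complex.I) / 10 : ℂ)}
    ({2 * (Real.pi : ℂ) * Complex.I, (Complex.log ((3 + 4 * Complex.I) / 10) / (2 * (Real.pi : ℂ) * Complex.I)), ((3 + 4 * Complex.I) / 10 : ℂ), (1 - 24 * ∑' l : ℕ, (ArithmeticFunction.sigma 1 (l + 1) : ℂ) *
        ((3 + 4 * Complex.I) / 10 : ℂ) ^ (l + 1)), (1 + 240 * ∑' l : ℕ, (ArithmeticFunction.sigma 3 (l + 1) : ℂ) *
        ((3 + 4 * Complex.I) / 10 : ℂ) ^ (l + 1)), (1 - 504 * ∑' l : ℕ, (ArithmeticFunction.sigma 5 (l + 1) : ℂ) *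
        ((3 + 4 * Complex.I) / 10 : ℂ) ^ (l + 1))} : Set ℂ)
    (fun x hx => by rw [Set.mem_singleton_iff.mp hx]; exact isAlgebraic_alpha0)
    (by
      intro x hx
      simp only [Set.mem_insert_iff, Set.mem_singleton_iff] at hx
      rcases hx with rfl | rfl | rfl | rfl | rfl | rfl
      · exact Or.inl ⟨0, by simp⟩
      · exact Or.inl ⟨1, by simp⟩
      · exact Or.inr rfl
      · exact Or.inl ⟨2, by simp⟩
      · exact Or.inl ⟨3, by simp⟩
      · exact Or.inl ⟨4, by simp⟩)
  exact_mod_cast h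

/-- **Without `τ` the count `5` is false** (so `τ = log q / 2πi` carries a full degree on the
algebraic-nome fibre): at `τ_α`, `trdeg ℚ(2πi, q, P, Q, R) ≤ 4` since `q = (3+4i)/10 ∈ ℚ̄`. -/
theorem tateLocusGPCOne_false_without_gen_tau :
    ¬ (∀ τ : ℂ, 0 < τ.im → (∀ b c : ℚ, τ ^ 2 + (b : ℂ) * τ + (c : ℂ) ≠ 0) →
      (5 : Cardinal) ≤ Algebra.trdeg ℚ ↥(adjoin ℚ
        ({2 * (Real.pi : ℂ) * Complex.I, Complex.exp (2 * Real.pi * Complex.I * τ),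
          1 - 24 * ∑' l : ℕ, (ArithmeticFunction.sigma 1 (l + 1) : ℂ) *
            Complex.exp (2 * Real.pi * Complex.I * τ) ^ (l + 1),
          1 + 240 * ∑' l : ℕ, (ArithmeticFunction.sigma 3 (l + 1) : ℂ) *
            Complex.exp (2 * Real.pi * Complex.I * τ) ^ (l + 1),
          1 - 504 * ∑' l : ℕ, (ArithmeticFunction.sigma 5 (l + 1) : ℂ) *
            Complex.exp (2 * Real.pi * Complex.I * τ) ^ (l + 1)} : Set ℂ))) := by
  intro h
  have h5 := h (Complex.log ((3 + 4 * Complex.I) / 10) / (2 * (Real.pi : ℂ) * Complex.I)) tauAlpha_im_pos tauAlpha_nonQuadratic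
  rw [exp_tauAlpha] at h5
  have h4 := trdeg_adjoin_le_of_subset_range_union
    ![2 * (Real.pi : ℂ) * Complex.I, (1 - 24 * ∑' l : ℕ, (ArithmeticFunction.sigma 1 (l + 1) : ℂ) *
        ((3 + 4 * Complex.I) / 10 : ℂ) ^ (l + 1)), (1 + 240 * ∑' l : ℕ, (ArithmeticFunction.sigma 3 (l + 1) : ℂ) *
        ((3 + 4 * Complex.I) / 10 : ℂ) ^ (l + 1)), (1 - 504 * ∑' l : ℕ, (ArithmeticFunction.sigma 5 (l + 1) : ℂ) *
        ((3 + 4 * Complex.I) / 10 : ℂ) ^ (l + 1))] {((3 + 4 * Complex.I) / 10 : ℂ)}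
    ({2 * (Real.pi : ℂ) * Complex.I, ((3 + 4 * Complex.I) / 10 : ℂ), (1 - 24 * ∑' l : ℕ, (ArithmeticFunction.sigma 1 (l + 1) : ℂ) *
        ((3 + 4 * Complex.I) / 10 : ℂ) ^ (l + 1)), (1 + 240 * ∑' l : ℕ, (ArithmeticFunction.sigma 3 (l + 1) : ℂ) *
        ((3 + 4 * Complex.I) / 10 : ℂ) ^ (l + 1)), (1 - 504 * ∑' l : ℕ, (ArithmeticFunction.sigma 5 (l + 1) : ℂ) *
        ((3 + 4 * Complex.I) / 10 : ℂ) ^ (l + 1))} : Set ℂ)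
    (fun x hx => by rw [Set.mem_singleton_iff.mp hx]; exact isAlgebraic_alpha0)
    (by
      intro x hx
      simp only [Set.mem_insert_iff, Set.mem_singleton_iff] at hx
      rcases hx with rfl | rfl | rfl | rfl | rfl
      · exact Or.inl ⟨0, by simp⟩
      · exact Or.inr rfl
      · exact Or.inl ⟨1, by simp⟩
      · exact Or.inl ⟨2, by simp⟩
      · exact Or.inl ⟨3, by simp⟩)
  have : (5 : Cardinal) ≤ 4 := h5.trans (by exact_mod_cast h4)
  norm_num at this

end algebraicNome

end Summit.Schanuel.Schanuel.Theorems.TateLocusGPCOne.Negative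

end
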